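import Summits.ResolutionOfSingularities.ResolutionOfSingularities.Theorems.FrobeniusClosingSteerSigmaTopLegality
import Summits.ResolutionOfSingularities.ResolutionOfSingularities.Theorems.FrobeniusClosingSteerCriticalSurface
import Summits.ResolutionOfSingularities.ResolutionOfSingularities.Theorems.FrobeniusClosingSteerLowTowerDictionary
import Literature.AlgebraicGeometry.Resolution.RsopMonomialIdeals
import Literature.AlgebraicGeometry.Resolution.RsopLocalization
import Literature.AlgebraicGeometry.Resolution.RegularLocalRingsQuotient
import Mathlib.RingTheory.KrullDimension.NonZeroDivisors
import HarnessLib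

/-!
# Steer σ-residual, LOW half — D3a leaf inputs: σ_top SEMANTICS read through the critical-surface thread (`hns`, `hT9`)

OURS (campaign res-hironaka, rung L ★L-G4, slot W4.1, crux `Steer` stmt-ResolutionOfSingularities-16345; res-L0-w41-plan-1
RULING 112a «second hand on the σ_top-semantics inputs of res-D-pv-012's leaf `lowTowerExistsTwo_holds`» := res-L0-w41-stub-3 g6;
replaces the role of no printed item; NOT a statement of the manuscript under review [claim: Hironaka2017, status: under-review];
AI review is weaker than expert review). Theses-free; the σ_top words are the TREE copies of `…SteerSigmaTopLegality`
(`IsSingPrime` / `IsTopSingComponent` / `IsPermissibleCentre`, VERBATIM bodies of the skeleton's, so skeleton-side hypotheses are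
accepted by `exact` through unfolding).

At a stage `R` (regular local, characteristic `2`) of the thread with radicand `f`, Jacobian pair `δ₁ f, δ₂ f` generating the trace `𝔮` of
the non-units of `Λ` (part of a regular system of parameters), σ_top centre `P` and an exceptional parameter `x ∈ P` which is a UNIT of `Λ`
(`CriticalThread.thread_step`):
* `isRegularLocalRing_torsor_at_trace` — **`hns`**: the torsor `T² = f` is REGULAR at `𝔮` (else every singular prime contains `𝔮` by C1, so
  `𝔮` is the top singular component, regular and `≠ 𝔪`, hence σ_top-permissible at `p = 2` (res-type-082's auto-equimultiplicity) — then
  σ_top's centre is a top singular component, i.e. `P = 𝔮 ∋ x`, a non-unit of `Λ`);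
* `isRegularLocalRing_torsor_image_of_pointStep` — **`hT9`**: at a POINT step, for every surjection `ρ : R ↠ S` onto a local ring with
  kernel `𝔮` and every prime `Q` of `S` off the closed point and off `⊥` with `S ⧸ Q` regular, the torsor `T² = ρ f` is regular at `Q`
  (else, by the surjective critical-surface dictionary `LowTower.singAlong_of_surjective`, `ρ⁻¹ Q` is a singular prime strictly
  above `𝔮` with regular quotient, a top singular component of the member — a permissible curve, which the point step excludes).
[cite: Matsumura1987, Thm. 14.2] [folklore]
-/

noncomputable section

-- single-problem summit: the doubled namespace component `ResolutionOfSingularities` is forced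
set_option linter.dupNamespace false

namespace Summit.ResolutionOfSingularities.ResolutionOfSingularities.Theorems.SwitchingDichotomy.LowTowerInputs

open IsLocalRing Polynomial
open Literature.AlgebraicGeometry.Resolution
open Summit.ResolutionOfSingularities.ResolutionOfSingularities.Theorems.SwitchingDichotomy
open Summit.ResolutionOfSingularities.ResolutionOfSingularities.Theorems.SwitchingDichotomy.SigmaTopLegality

variable {K : Type} [Field K] [CharP K 2]

/-! ## `hns`: the torsor is regular at the critical prime -/

/-- **`hns` at one stage.** `R ⊆ K` regular local (characteristic `2`), `Λ ⊇ R` a subring, `f ∈ R`, derivations `δ₁, δ₂` with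
(I1) `r ∈ (δ₁ f, δ₂ f) ↔ r` is a non-unit of `Λ` and (I2) `(δ₁ f, δ₂ f)` part of a regular system of parameters; `P` the σ_top centre
at `(R, f)` (tree words, `p = 2`); `x ∈ P` a unit of `Λ` (no surface step — `CriticalThread.thread_step`). Then for the prime `Q` of `R`
cut out by the non-units of `Λ` (`= (δ₁ f, δ₂ f)`), the torsor `T² = f` over `R_Q` is a regular local ring. [cite: Matsumura1987, Thm. 14.2] -/
theorem isRegularLocalRing_torsor_at_trace {R Λ : Subring K} [IsRegularLocalRing R] (hle : R ≤ Λ)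
    (f : R) (δ₁ δ₂ : Derivation ℤ R R)
    (hI1 : ∀ r : R, r ∈ Ideal.span {δ₁ f, δ₂ f} ↔ ¬ IsUnit (⟨(r : K), hle r.2⟩ : Λ))
    (hI2 : IsRsopPart ![δ₁ f, δ₂ f])
    {P : Ideal R}
    (hσ : IsPermissibleCentre R 2 f P ∨
      (P = maximalIdeal R ∧ (∀ Q : Ideal R, ¬ IsPermissibleCentre R 2 f Q) ∧ ∃ g : R, f - g ^ 2 ∈ maximalIdeal R ^ 2))
    {x : K} (hxR : x ∈ R) (hxP : (⟨x, hxR⟩ : R) ∈ P) (hxu : IsUnit (⟨x, hle hxR⟩ : Λ))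
    (Q : Ideal R) [Q.IsPrime] (hQ : ∀ r : R, r ∈ Q ↔ ¬ IsUnit (⟨(r : K), hle r.2⟩ : Λ)) :
    IsRegularLocalRing (AdjoinRoot ((X : (Localization.AtPrime Q)[X]) ^ 2 -
      C (algebraMap R (Localization.AtPrime Q) f))) := by
  classical
  haveI : Fact (2 : ℕ).Prime := ⟨Nat.prime_two⟩
  -- `Q = 𝔮 := (δ₁ f, δ₂ f)`
  have hQq : Q = Ideal.span {δ₁ f, δ₂ f} := by
    ext r; rw [hQ, hI1]
  subst hQq
  by_contra hsing
  -- every singular prime contains `𝔮` (C1)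
  have hC1 : ∀ (Q' : Ideal R) [Q'.IsPrime], IsSingPrime R 2 f Q' → Ideal.span {δ₁ f, δ₂ f} ≤ Q' := by
    intro Q' _ hQ'
    rw [Ideal.span_le]
    rintro _ (rfl | rfl)
    · exact CriticalSurface.derivation_apply_mem_of_singular R f Q' hQ' δ₁
    · exact CriticalSurface.derivation_apply_mem_of_singular R f Q' hQ' δ₂
  -- so `𝔮` is the top singular component, with regular quotient, and not the closed point
  have htop : IsTopSingComponent R 2 f (Ideal.span {δ₁ f, δ₂ f}) := by
    refine ⟨inferInstance, hsing, fun Q' _ hQ' hle' => le_antisymm hle' (hC1 Q' hQ'), fun Q' _ hQ' hmin => ?_⟩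
    rw [hmin (Ideal.span {δ₁ f, δ₂ f}) hsing (hC1 Q' hQ')]
  have hreg : IsRegularLocalRing (R ⧸ Ideal.span {δ₁ f, δ₂ f}) := by
    have h := hI2.isRegularLocalRing_quotient
    rwa [CriticalSurface.span_range_pair] at h
  have hPm : P ≤ maximalIdeal R := by
    rcases hσ with ⟨hne, ⟨hprime, -⟩, -⟩ | ⟨hPt, -⟩
    · haveI := hprime; exact IsLocalRing.le_maximalIdeal (Ideal.IsPrime.ne_top inferInstance)
    · exact hPt.le
  have hxq : (⟨x, hxR⟩ : R) ∉ Ideal.span {δ₁ f, δ₂ f} := fun h => (hI1 _).mp h hxu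
  have hne : Ideal.span {δ₁ f, δ₂ f} ≠ maximalIdeal R := fun h => hxq (h ▸ hPm hxP)
  have hperm : IsPermissibleCentre R 2 f (Ideal.span {δ₁ f, δ₂ f}) :=
    (isPermissibleCentre_two_iff R f _).mpr ⟨hne, htop, hreg⟩
  rcases hσ with hP | ⟨-, hnone, -⟩
  · -- the centre is a top singular component, hence `= 𝔮`, which contains the `Λ`-unit `x`
    obtain ⟨-, ⟨hprime, hPsing, hPmin, -⟩, -, -⟩ := hP
    haveI := hprime
    have hqP : Ideal.span {δ₁ f, δ₂ f} = P := hPmin (Ideal.span {δ₁ f, δ₂ f}) hsing (hC1 P hPsing)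
    exact hxq (hqP ▸ hxP)
  · exact hnone _ hperm


/-! ## `hT9`: at a point step the surface torsor has no singular regular curve -/

/-- **`hT9` UPSTAIRS at one (point) stage.** `R ⊆ K` regular local of dimension `4` (characteristic `2`), `Λ ⊇ R`, radicand `f`, Jacobian pair
`δ₁ f, δ₂ f` with (I1)(I2)(I3) (trace of the non-units of `Λ`, part of a regular system of parameters, unit Hessian), the torsor REGULAR at
the critical prime (`hns`), and σ_top taking the POINT step (no permissible centre). Then for every surjection `ρ : R ↠ S` onto a local ring
with kernel the critical prime and every prime `Q` of `S`, `Q ≠ ⊥`, `Q ≠ 𝔪_S`, `S ⧸ Q` regular, the torsor `T² = ρ f` over `S_Q` is regular: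
otherwise `ρ⁻¹ Q` is a singular prime of `R` (surjective critical-surface dictionary), strictly between the critical prime and `𝔪`, with
regular quotient — a top singular component of height `3`, i.e. a σ_top-permissible curve. [cite: Matsumura1987, Thm. 14.2] -/
theorem isRegularLocalRing_torsor_of_pointStep_upstairs {R Λ : Subring K} [IsRegularLocalRing R] (hle : R ≤ Λ)
    (hdim : ringKrullDim R = (4 : ℕ)) (f : R) (δ₁ δ₂ : Derivation ℤ R R)
    (hI1 : ∀ r : R, r ∈ Ideal.span {δ₁ f, δ₂ f} ↔ ¬ IsUnit (⟨(r : K), hle r.2⟩ : Λ))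
    (hI2 : IsRsopPart ![δ₁ f, δ₂ f])
    (hpoint : ∀ Q : Ideal R, ¬ IsPermissibleCentre R 2 f Q)
    (hns : ∀ (Q : Ideal R) [Q.IsPrime], (∀ r : R, r ∈ Q ↔ ¬ IsUnit (⟨(r : K), hle r.2⟩ : Λ)) →
      IsRegularLocalRing (AdjoinRoot ((X : (Localization.AtPrime Q)[X]) ^ 2 -
        C (algebraMap R (Localization.AtPrime Q) f))))
    (Qt : Ideal R) [Qt.IsPrime] (_hqQt : Ideal.span {δ₁ f, δ₂ f} ≤ Qt) (hQtm : Qt ≠ maximalIdeal R)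
    (hQtreg : IsRegularLocalRing (R ⧸ Qt)) :
    IsRegularLocalRing (AdjoinRoot ((X : (Localization.AtPrime Qt)[X]) ^ 2 -
      C (algebraMap R (Localization.AtPrime Qt) f))) := by
  classical
  haveI : Fact (2 : ℕ).Prime := ⟨Nat.prime_two⟩
  haveI : CharP R 2 := inferInstance
  set 𝔮 : Ideal R := Ideal.span {δ₁ f, δ₂ f} with hq
  haveI hqprime : 𝔮.IsPrime := by
    have h := hI2.isPrime_span_range
    rwa [CriticalSurface.span_range_pair] at h
  haveI hregq : IsRegularLocalRing (R ⧸ 𝔮) := by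
    have h := hI2.isRegularLocalRing_quotient
    rwa [CriticalSurface.span_range_pair] at h
  by_contra hsingQ
  have hsing : IsSingPrime R 2 f Qt := hsingQ
  -- singular primes lie STRICTLY above `𝔮` (C1 + `hns`)
  have hC1 : ∀ (Q' : Ideal R) [Q'.IsPrime], IsSingPrime R 2 f Q' → 𝔮 < Q' := by
    intro Q' _ hQ'
    refine lt_of_le_of_ne ?_ ?_
    · rw [hq, Ideal.span_le]
      rintro _ (rfl | rfl)
      · exact CriticalSurface.derivation_apply_mem_of_singular R f Q' hQ' δ₁
      · exact CriticalSurface.derivation_apply_mem_of_singular R f Q' hQ' δ₂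
    · intro hQ'q
      subst hQ'q
      exact hQ' (hns _ hI1)
  -- heights: `ht 𝔮 = 2`, `ht 𝔪 = 4`, so a singular prime `≠ 𝔪` has height `3`
  have hhtq : 𝔮.height = 2 := by
    have h := hI2.height_span_range
    rwa [CriticalSurface.span_range_pair] at h
  have hhtm : (maximalIdeal R).height = ((4 : ℕ) : ℕ∞) := by
    have h := IsLocalRing.maximalIdeal_height_eq_ringKrullDim (R := R)
    rw [hdim] at h
    have h' : ((maximalIdeal R).height : WithBot ℕ∞) = (((4 : ℕ) : ℕ∞) : WithBot ℕ∞) := by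
      rw [h, WithBot.coe_natCast]
    exact WithBot.coe_injective h' 
  have hht3 : ∀ (Q' : Ideal R) [Q'.IsPrime], IsSingPrime R 2 f Q' → Q' ≠ maximalIdeal R → Q'.height = ((3 : ℕ) : ℕ∞) := by
    intro Q' hQ'p hQ' hQ'm
    have h1 : 𝔮.height < Q'.height := Ideal.height_strict_mono_of_isPrime (hC1 Q' hQ')
    have h2 : Q'.height < (maximalIdeal R).height :=
      Ideal.height_strict_mono_of_isPrime
        (lt_of_le_of_ne (IsLocalRing.le_maximalIdeal (Ideal.IsPrime.ne_top hQ'p)) hQ'm)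
    rw [hhtq] at h1
    rw [hhtm] at h2
    have hfin : Q'.height ≠ ⊤ := Q'.height_ne_top (Ideal.IsPrime.ne_top hQ'p)
    obtain ⟨m, hm⟩ := ENat.ne_top_iff_exists.mp hfin
    rw [← hm] at h1 h2 ⊢
    have h1' : (2 : ℕ) < m := by exact_mod_cast h1
    have h2' : m < 4 := by exact_mod_cast h2
    have : m = 3 := by omega
    exact_mod_cast this
  -- dimensions: `dim R ⧸ Q' ≤ 1` for a prime strictly above `𝔮`, and `dim R ⧸ Qt ≥ 1`
  have hdimq : ringKrullDim (R ⧸ 𝔮) = (2 : ℕ) := by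
    have h := hI2.ringKrullDim_quotient_add
    rw [CriticalSurface.span_range_pair, hdim] at h
    obtain ⟨k, hk⟩ := exists_nat_cast_eq_ringKrullDim (R := R ⧸ 𝔮)
    rw [hk] at h ⊢
    have hk2 : k + 2 = 4 := by exact_mod_cast h
    exact_mod_cast (show k = 2 by omega)
  have hle1 : ∀ (Q' : Ideal R) [Q'.IsPrime], 𝔮 < Q' → ringKrullDim (R ⧸ Q') ≤ (1 : ℕ) := by
    intro Q' hQ'p hlt
    obtain ⟨y, hyQ', hyq⟩ := Set.exists_of_ssubset hlt
    -- `ȳ ≠ 0` in the domain `R ⧸ 𝔮`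
    haveI : IsDomain (R ⧸ 𝔮) := Ideal.Quotient.isDomain 𝔮
    have hy0 : Ideal.Quotient.mk 𝔮 y ≠ 0 := fun h => hyq (Ideal.Quotient.eq_zero_iff_mem.mp h)
    have h1 := ringKrullDim_quotient_succ_le_of_nonZeroDivisor (mem_nonZeroDivisors_of_ne_zero hy0)
    rw [hdimq] at h1
    -- `R ⧸ Q'` is a quotient of `(R ⧸ 𝔮) ⧸ (ȳ) ≅ R ⧸ (𝔮 + (y))`
    have hsurj : Function.Surjective (Ideal.Quotient.factor
        (show 𝔮 ⊔ Ideal.span {y} ≤ Q' from sup_le hlt.le ((Ideal.span_singleton_le_iff_mem _).mpr hyQ'))) :=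
      Ideal.Quotient.factor_surjective _
    have h2 := ringKrullDim_le_of_surjective _ hsurj
    have e : (R ⧸ 𝔮) ⧸ Ideal.span {Ideal.Quotient.mk 𝔮 y} ≃+* R ⧸ (𝔮 ⊔ Ideal.span {y}) := by
      have : Ideal.span {Ideal.Quotient.mk 𝔮 y} = (Ideal.span {y}).map (Ideal.Quotient.mk 𝔮) := by
        rw [Ideal.map_span, Set.image_singleton]
      exact (Ideal.quotEquivOfEq this).trans (DoubleQuot.quotQuotEquivQuotSup 𝔮 (Ideal.span {y}))
    have h3 : ringKrullDim (R ⧸ (𝔮 ⊔ Ideal.span {y})) = ringKrullDim ((R ⧸ 𝔮) ⧸ Ideal.span {Ideal.Quotient.mk 𝔮 y}) :=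
      (ringKrullDim_eq_of_ringEquiv e).symm
    rw [h3] at h2
    -- `dim (R ⧸ Q')` is a natural number
    haveI : IsLocalRing (R ⧸ Q') := isLocalRing_quotient (Ideal.IsPrime.ne_top hQ'p)
    obtain ⟨k, hk⟩ := exists_nat_cast_eq_ringKrullDim (R := R ⧸ Q')
    rw [hk] at h2 ⊢
    have h4 : (k : WithBot ℕ∞) + 1 ≤ (2 : ℕ) := (add_le_add h2 le_rfl).trans h1
    have hk1 : k + 1 ≤ 2 := by exact_mod_cast h4
    exact_mod_cast (show k ≤ 1 by omega)
  have hge1 : ((1 : ℕ) : WithBot ℕ∞) ≤ ringKrullDim (R ⧸ Qt) := by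
    haveI := hQtreg
    haveI : IsDomain (R ⧸ Qt) := Ideal.Quotient.isDomain Qt
    have hm0 : maximalIdeal (R ⧸ Qt) ≠ ⊥ := by
      intro h
      apply hQtm
      refine le_antisymm (IsLocalRing.le_maximalIdeal (Ideal.IsPrime.ne_top inferInstance)) fun r hr => ?_
      have : Ideal.Quotient.mk Qt r ∈ maximalIdeal (R ⧸ Qt) := by
        rw [← IsLocalRing.map_maximalIdeal_of_surjective (Ideal.Quotient.mk Qt) Ideal.Quotient.mk_surjective]
        exact Ideal.mem_map_of_mem _ hr
      rw [h] at this
      exact Ideal.Quotient.eq_zero_iff_mem.mp this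
    have hlt : (⊥ : Ideal (R ⧸ Qt)) < maximalIdeal (R ⧸ Qt) := bot_lt_iff_ne_bot.mpr hm0
    haveI : (⊥ : Ideal (R ⧸ Qt)).IsPrime := Ideal.isPrime_bot
    have h := Ideal.height_strict_mono_of_isPrime hlt
    have h1 : (1 : ℕ∞) ≤ (maximalIdeal (R ⧸ Qt)).height :=
      Order.one_le_iff_pos.mpr (lt_of_le_of_lt bot_le h)
    rw [← IsLocalRing.maximalIdeal_height_eq_ringKrullDim]
    exact_mod_cast h1
  -- `Qt` is a top singular component: a σ_top-permissible curve — excluded by the point step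
  have htop : IsTopSingComponent R 2 f Qt := by
    refine ⟨inferInstance, hsing, fun Q' hQ'p hQ' hle' => ?_, fun Q' hQ'p hQ' hmin => ?_⟩
    · by_contra hne
      have hQ'm : Q' ≠ maximalIdeal R := fun h' =>
        hQtm (le_antisymm (IsLocalRing.le_maximalIdeal (Ideal.IsPrime.ne_top inferInstance)) (h' ▸ hle'))
      have h := Ideal.height_strict_mono_of_isPrime (lt_of_le_of_ne hle' hne)
      rw [hht3 Q' hQ' hQ'm, hht3 Qt hsing hQtm] at h
      exact lt_irrefl _ h
    · have hQ'm : Q' ≠ maximalIdeal R := by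
        intro h'
        have hQt' : Qt = Q' := hmin Qt hsing (h' ▸ IsLocalRing.le_maximalIdeal (Ideal.IsPrime.ne_top inferInstance))
        exact hQtm (hQt'.trans h')
      exact (hle1 Q' (hC1 Q' hQ')).trans hge1
  exact hpoint Qt ((isPermissibleCentre_two_iff R f Qt).mpr ⟨hQtm, htop, hQtreg⟩)

/-- **`hT9` at one (point) stage, image-quantified** (res-D-pv-012's binder shape): for every surjection `ρ : R ↠ S` onto a local ring with
kernel the critical prime and every prime `Q` of `S` off `⊥` and off the closed point with `S ⧸ Q` regular, the torsor `T² = ρ f` over `S_Q`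
is regular — the upstairs statement transported along the surjective critical-surface dictionary `LowTower.singAlong_of_surjective`.
[cite: Matsumura1987, Thm. 14.2] -/
theorem isRegularLocalRing_torsor_image_of_pointStep {R Λ : Subring K} [IsRegularLocalRing R] (hle : R ≤ Λ)
    (hdim : ringKrullDim R = (4 : ℕ)) (f : R) (δ₁ δ₂ : Derivation ℤ R R)
    (hI1 : ∀ r : R, r ∈ Ideal.span {δ₁ f, δ₂ f} ↔ ¬ IsUnit (⟨(r : K), hle r.2⟩ : Λ))
    (hI2 : IsRsopPart ![δ₁ f, δ₂ f])
    (hI3 : IsUnit (δ₁ (δ₁ f) * δ₂ (δ₂ f) - δ₁ (δ₂ f) * δ₂ (δ₁ f)))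
    (hpoint : ∀ Q : Ideal R, ¬ IsPermissibleCentre R 2 f Q)
    (hns : ∀ (Q : Ideal R) [Q.IsPrime], (∀ r : R, r ∈ Q ↔ ¬ IsUnit (⟨(r : K), hle r.2⟩ : Λ)) →
      IsRegularLocalRing (AdjoinRoot ((X : (Localization.AtPrime Q)[X]) ^ 2 -
        C (algebraMap R (Localization.AtPrime Q) f))))
    (S : Type) [CommRing S] [IsLocalRing S] (ρ : R →+* S) (hρ : Function.Surjective ρ)
    (hker : ∀ r : R, ρ r = 0 ↔ ¬ IsUnit (⟨(r : K), hle r.2⟩ : Λ))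
    (Q : Ideal S) [Q.IsPrime] (_hQ0 : Q ≠ ⊥) (hQm : Q ≠ maximalIdeal S) (hQreg : IsRegularLocalRing (S ⧸ Q)) :
    IsRegularLocalRing (AdjoinRoot ((X : (Localization.AtPrime Q)[X]) ^ 2 -
      C (algebraMap S (Localization.AtPrime Q) (ρ f)))) := by
  classical
  haveI : Fact (2 : ℕ).Prime := ⟨Nat.prime_two⟩
  haveI : CharP R 2 := inferInstance
  set 𝔮 : Ideal R := Ideal.span {δ₁ f, δ₂ f} with hq
  have hker' : ∀ r : R, ρ r = 0 ↔ r ∈ 𝔮 := fun r => (hker r).trans (hI1 r).symm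
  have hkerq : RingHom.ker ρ = 𝔮 := by ext r; rw [RingHom.mem_ker, hker']
  haveI hregq : IsRegularLocalRing (R ⧸ 𝔮) := by
    have h := hI2.isRegularLocalRing_quotient
    rwa [CriticalSurface.span_range_pair] at h
  haveI : IsRegularLocalRing S :=
    IsRegularLocalRing.of_ringEquiv ((Ideal.quotEquivOfEq hkerq.symm).trans (RingHom.quotientKerEquivOfSurjective hρ))
  haveI : CharP S 2 := by
    refine (CharP.charP_iff_prime_eq_zero Nat.prime_two).mpr ?_
    rw [← map_natCast ρ 2, CharP.cast_eq_zero R 2, map_zero]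
  by_contra hsingQ
  set Qt : Ideal R := Q.comap ρ with hQt
  haveI : Qt.IsPrime := Ideal.comap_isPrime ρ Q
  have hsing : ¬ IsRegularLocalRing (AdjoinRoot ((X : (Localization.AtPrime Qt)[X]) ^ 2 -
      C (algebraMap R (Localization.AtPrime Qt) f))) :=
    (LowTower.singAlong_of_surjective ρ hρ f δ₁ δ₂ hker' hI3 Q).mpr hsingQ
  have hqQt : 𝔮 ≤ Qt := fun r hr => by
    change ρ r ∈ Q
    rw [(hker' r).mpr hr]
    exact Q.zero_mem
  have hQtm : Qt ≠ maximalIdeal R := by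
    intro h
    apply hQm
    rw [← Ideal.map_comap_of_surjective ρ hρ Q, ← hQt, h, IsLocalRing.map_maximalIdeal_of_surjective ρ hρ]
  have hQtreg : IsRegularLocalRing (R ⧸ Qt) := by
    have hk : RingHom.ker ((Ideal.Quotient.mk Q).comp ρ) = Qt := by
      rw [← RingHom.comap_ker, Ideal.mk_ker]
    haveI := hQreg
    exact IsRegularLocalRing.of_ringEquiv
      ((Ideal.quotEquivOfEq hk.symm).trans
        (RingHom.quotientKerEquivOfSurjective (Ideal.Quotient.mk_surjective.comp hρ))).symm
  exact hsing (isRegularLocalRing_torsor_of_pointStep_upstairs hle hdim f δ₁ δ₂ hI1 hI2 hpoint hns Qt hqQt hQtm hQtreg)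

end Summit.ResolutionOfSingularities.ResolutionOfSingularities.Theorems.SwitchingDichotomy.LowTowerInputs

end
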